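import Literature.Claims.NS.ClayVariants
import Literature.Analysis.FluidPDE.ClassicalSolution
import Mathlib.Analysis.SpecialFunctions.Log.Base
import Mathlib.Analysis.SpecialFunctions.Pow.Real
import HarnessLib

/-!
# Claim skeleton (QUICK, T3 tranche tail): Shoji (2026), «Global Regularity of the 3D Navier-Stokes
# Equations: A Logical Cost Functional Approach via Resource-Constrained Analysis»

Cell `ns-claims` (D-0090 NS-CLAIMS SWEEP), claim C92, typist `ns-claims-typist-9` (g2). UNREFEREED CLAIM
under adjudication — NOTHING in this file asserts a step: every `Step…` declaration is a `Prop`; the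
`theorem`s are the composition of the paper's own chain and the Clay link.

Version of record: Takayuki Shoji, Zenodo record 18483326 (only version, 2026-02-04) = open copy of SSRN
6176119; 17 PDF pp. (PDF page = only pagination). Texts: `pub/ns-claims/sources/Shoji2026/Zenodo-18483326/
{pages/pNNN.txt, renders/pNNN.png}` (ns-claims-lit-1 g6); the displays of Theorems 4.1–4.4 are typed
from the renders p007–p009 (the text layer drops the square roots). Bib key `Shoji2026`.

## Claimed statement (as printed)

Abstract p.2: «This paper establishes the global regularity of solutions to the 3D Navier-Stokes equations
by reconstructing the analytical framework within a Resource-Constrained Logical System embedded in ZFC»;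
Zenodo description: «a definitive proof of the global regularity of the three-dimensional incompressible
Navier-Stokes equations, resolving a long-standing Millennium Prize Problem»; **Theorem 4.4 (Global
Regularity)** p.9: «… ∴ No blow-up is possible. Q.E.D.» Setting: ℝ³ (Littlewood–Paley in `ξ`, Def. 2.1
p.5), `f ≡ 0`, «any weak solution» of finite energy (Thm 3.1 p.6). Typed: `ClaimedTheorem :=
ClayVariants.clayR3.Regularity` (Clay (A), cited not restated).

## Clay delta — none typed (ℝ³, f ≡ 0, finite-energy data ⊇ Clay (4); continuation via BKM, Δ6 bridged
by the criterion the paper cites); the «Resource-Constrained Logical System» framing (Ch. 1–3) carries no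
typed content — the estimates of Ch. 4 are ordinary inequalities and are typed as such.

## Steps — Chapter 4 «The Embedding Theorems (The Core Proof)» in print = dependency order (QUICK grain)

The «Logical Cost / Depth» `N(t) := inf{k ∈ ℕ : Σ_{j>k} ‖Δ_j u‖_{L∞} < ε}` (Def. 2.2 p.5) is a
Littlewood–Paley object the tree does not carry; it enters as an abstract ATTACHMENT `N : Depth`
(a parameter of the steps: solution ↦ time ↦ ℕ). `D(t) = ν‖∇u(t)‖²_{L²}` (Thm 3.1 p.6) is typed concretely
(`dissipation`).

* Step 1 = `Step1_Thm41 N` — Theorem 4.1 (Logarithmic Embedding) p.7: «Using Bernstein's inequality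
  ‖Δ_j u‖_{L∞} ≲ 2^{3j/2}‖Δ_j u‖_{L²}, and the Brezis–Gallouet–Wainger technique … We derive the strict
  bound: ‖ω(t)‖_{L∞} ≤ K·‖u‖_{H¹}·√N(t)». SUSPICIOUS (typist; supercritical: the shells `j ≤ N` give
  `2^{3N/2}`, not `√N`; BGW needs `H^{3/2}` in 3D) — on paper; no kernel face at QUICK grain (N abstract).
* **Step 2 = `Step2_Thm42 N`** — Theorem 4.2 (Minimum Maintenance Cost) p.8: «D(t) = νΣ_j‖∇Δ_j u‖²_{L²}
  ∼ νΣ_{j=−1}^{N(t)} 4^j‖Δ_j u‖²_{L²}. For the layer N(t) to be active, it must carry non-zero energy δ.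
  Therefore, we have a lower bound: D(t) ≥ ν·δ·4^{N(t)}» — with `δ > 0` a constant (it is inverted in
  Thm 4.3 and divides inside the logarithm of Thm 4.4, «independent of the flow history»). KERNEL TARGET
  (typist): false for the rest state and for every decaying flow at large times, whatever `N` is.
* Step 3 = `Step3_Thm43 N` — Theorem 4.3 (The Finite Capacity Bound) p.8: «N(t) ≤ ½ log₂(D(t)/(νδ)).
  This bound holds pointwise in time, independent of the flow history.»
* Step 4 = `Step4_Thm44 N` — Theorem 4.4 p.9: «Substituting Theorem 4.1 and Theorem 4.3: ‖ω(t)‖_{L∞} ≤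
  K√N(t) ≤ K√(½log₂(D(t)/(νδ))) … ∫₀^T‖ω(t)‖_{L∞}dt ≤ C∫₀^T √(log D(t)) dt. Since ∫₀^T D(t)dt ≤ E₀ < ∞
  (Leray Bound), and √(log x) ≪ x for large x, the integral is finite. ∴ No blow-up is possible.» —
  typed as the asserted implication (Step 1 ∧ Step 3) → `ClaimedTheorem` (BKM bridge included).

## COMPOSITION — `claim_of_steps N : Step1 N → Step2 N → Step3 N → Step4 N → ClaimedTheorem` (PROVED;
## Step 2 feeds Step 3 in print — «Inverting the above inequality» — and is underscored in the kernel).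

WHAT THIS IS NOT: not a claim about NS regularity or blow-up; not a claim about any author beyond the
typed locator.
-/

noncomputable section

open Set MeasureTheory

namespace Literature.Claims.NS.Shoji2026

open Literature.Analysis.FluidPDE

/-! ## §A. Vocabulary -/

/-- Physical space `ℝ³`. [cite: Shoji2026, Def. 2.1 p.5] -/
abbrev E3 : Type := EuclideanSpace ℝ (Fin 3)

/-- The «Logical Cost / Depth» attachment `N(t) ∈ ℕ` of Def. 2.2 p.5 (`inf{k ∈ ℕ : Σ_{j>k}‖Δ_j u‖_{L∞} < ε}`,
Littlewood–Paley), as an abstract map solution ↦ time ↦ ℕ (QUICK grain: not constructed).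
[cite: Shoji2026, Def. 2.2 p.5] -/
abbrev Depth : Type := (ℝ → E3 → E3) → ℝ → ℕ

/-- Instantaneous dissipation `D(t) := ν‖∇u(t)‖²_{L²}` (Thm 3.1 p.6). Bochner integral.
[cite: Shoji2026, Theorem 3.1 p.6] -/
def dissipation (ν : ℝ) (u : ℝ → E3 → E3) (t : ℝ) : ℝ :=
  ν * ∫ x, ‖fderiv ℝ (u t) x‖ ^ 2

/-- `‖u(t)‖_{H¹} = (‖u‖²_{L²} + ‖∇u‖²_{L²})^{1/2}` (Thm 4.1 p.7). Bochner integrals.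
[cite: Shoji2026, Theorem 4.1 p.7] -/
def h1Norm (v : E3 → E3) : ℝ :=
  Real.sqrt ((∫ x, ‖v x‖ ^ 2) + ∫ x, ‖fderiv ℝ v x‖ ^ 2)

/-- «The solution» the theorems speak of (Thm 3.1 p.6 «any weak solution»; Ch. 4): a classical solution of
the UNFORCED system on `ℝ³ × [0,∞)` with viscosity `ν` and bounded energy (Fefferman's (7)).
[cite: Shoji2026, Theorem 3.1 p.6] -/
def IsFlow (ν : ℝ) (u : ℝ → E3 → E3) (p : ℝ → E3 → ℝ) : Prop :=
  IsClassicalNSSolutionOn (Ici 0) ν 0 u p ∧ HasBoundedEnergy u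

/-! ## §B. The claimed statement and the Clay link -/

/-- **CLAIMED THEOREM** (abstract p.2; Theorem 4.4 p.9 «No blow-up is possible»; Zenodo description
«resolving a long-standing Millennium Prize Problem») = Clay (A), cited through `ClayVariants`.
[cite: Shoji2026, Theorem 4.4 p.9; abstract p.2] -/
def ClaimedTheorem : Prop :=
  ClayVariants.clayR3.Regularity

/-- The claim is (A) (definitional). [cite: Shoji2026, Theorem 4.4 p.9] -/
theorem clay_of_claimed (h : ClaimedTheorem) : ClayVariants.clayR3.Regularity := h

/-- … and conversely. [cite: Shoji2026, Theorem 4.4 p.9] -/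
theorem claimedTheorem_iff : ClaimedTheorem ↔ ClayVariants.clayR3.Regularity := Iff.rfl

/-! ## §C. The steps (Chapter 4, print order) -/

/-- **Step 1** — Theorem 4.1 (Logarithmic Embedding) p.7 (render p007.png): «Using Bernstein's inequality
‖Δ_j u‖_{L∞} ≲ 2^{3j/2}‖Δ_j u‖_{L²}, and the Brezis–Gallouet–Wainger technique: ‖u‖_{L∞} ≤ CΣ_{j=−1}^{N(t)}
2^{3j/2}‖Δ_j u‖_{L²} + ε. We derive the strict bound: ‖ω(t)‖_{L∞} ≤ K·‖u‖_{H¹}·√N(t)»: one constant `K`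
such that, along every flow and at every time, the vorticity is pointwise bounded by `K‖u(t)‖_{H¹}√N(t)`.
[cite: Shoji2026, Theorem 4.1 p.7] -/
def Step1_Thm41 (N : Depth) : Prop :=
  ∃ K : ℝ, ∀ (ν : ℝ) (u : ℝ → E3 → E3) (p : ℝ → E3 → ℝ), 0 < ν → IsFlow ν u p →
    ∀ t : ℝ, 0 ≤ t → ∀ x : E3, ‖curl (u t) x‖ ≤ K * h1Norm (u t) * Real.sqrt (N u t)

/-- **Step 2 — KERNEL TARGET** — Theorem 4.2 (Minimum Maintenance Cost) p.8 (render p008.png): «The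
dissipation rate D(t) is determined by the active frequencies: D(t) = νΣ_j‖∇Δ_j u‖²_{L²} ∼
νΣ_{j=−1}^{N(t)} 4^j‖Δ_j u‖²_{L²}. For the layer N(t) to be active, it must carry non-zero energy δ.
Therefore, we have a lower bound: D(t) ≥ ν·δ·4^{N(t)}» — `δ > 0` one constant («independent of the flow
history», Thm 4.3). [cite: Shoji2026, Theorem 4.2 p.8] -/
def Step2_Thm42 (N : Depth) : Prop :=
  ∃ δ : ℝ, 0 < δ ∧ ∀ (ν : ℝ) (u : ℝ → E3 → E3) (p : ℝ → E3 → ℝ), 0 < ν → IsFlow ν u p →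
    ∀ t : ℝ, 0 ≤ t → ν * δ * (4 : ℝ) ^ (N u t) ≤ dissipation ν u t

/-- **Step 3** — Theorem 4.3 (The Finite Capacity Bound) p.8: «Inverting the above inequality gives an
algebraic bound on N(t): N(t) ≤ ½ log₂(D(t)/(νδ)). This bound holds pointwise in time, independent of the
flow history.» (`Real.logb 2`; for `D(t) = 0` Lean's `logb 2 0 = 0` is a junk value the print does not
face — the step is typed as printed.) [cite: Shoji2026, Theorem 4.3 p.8] -/
def Step3_Thm43 (N : Depth) : Prop :=
  ∃ δ : ℝ, 0 < δ ∧ ∀ (ν : ℝ) (u : ℝ → E3 → E3) (p : ℝ → E3 → ℝ), 0 < ν → IsFlow ν u p →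
    ∀ t : ℝ, 0 ≤ t → (N u t : ℝ) ≤ 1 / 2 * Real.logb 2 (dissipation ν u t / (ν * δ))

/-- **Step 4** — Theorem 4.4 (Global Regularity) p.9 (render p009.png): «The BKM criterion requires
∫₀^T‖ω(t)‖_{L∞}dt < ∞. Substituting Theorem 4.1 and Theorem 4.3: ‖ω(t)‖_{L∞} ≤ K√N(t) ≤
K√(½log₂(D(t)/(νδ))). We examine the integrability: ∫₀^T‖ω(t)‖_{L∞}dt ≤ C∫₀^T√(log D(t))dt. Since
∫₀^T D(t)dt ≤ E₀ < ∞ (Leray Bound), and √(log x) ≪ x for large x, the integral is finite. ∴ No blow-up is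
possible. Q.E.D.» — the asserted passage from Theorems 4.1 and 4.3 to the claim (the factor ‖u‖_{H¹} of
Thm 4.1 is dropped in the display; BKM bridge included). [cite: Shoji2026, Theorem 4.4 p.9] -/
def Step4_Thm44 (N : Depth) : Prop :=
  (Step1_Thm41 N ∧ Step3_Thm43 N) → ClaimedTheorem

/-! ## §D. Composition (kernel) -/

/-- **COMPOSITION** — Chapter 4 in print order; Step 2 is consumed by Step 3 in print («Inverting the above
inequality») and underscored here. PROVED. [cite: Shoji2026, Theorem 4.4 p.9] -/
theorem claim_of_steps (N : Depth) (h1 : Step1_Thm41 N) (_h2 : Step2_Thm42 N) (h3 : Step3_Thm43 N)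
    (h4 : Step4_Thm44 N) : ClaimedTheorem :=
  h4 ⟨h1, h3⟩

end Literature.Claims.NS.Shoji2026

end
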